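import Literature.Barriers.AtomisticToContinuum.StickySphereClusters
import HarnessLib

/-!
# Contact numbers of finite unit-ball packings in `ℝ³`: the Bezdek–Reid bounds

Topic `Literature/Geometry/DiscreteGeometry` (contact graphs of unit-ball packings; companion of
`FejesTothKissingTwelve.lean` — `IsUnitBallPacking`, balls of RADIUS `1`, touching centres at
distance `2` — and of `Literature/Barriers/AtomisticToContinuum/StickySphereClusters.lean`, whose
`contactNumber x` (number of pairs `i < j` with `dist (x i) (x j) = 2` of a labelled configuration
`x : Fin n → ℝ³`), `intContactNumber`, `intConfig`, `contactNumber_scaled`,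
`isUnitBallPacking_scaled` are reused, not re-declared).  Vendored for the venture cell
`pub-crystal3d` (exact contact-graph enumeration + linear programming over local inequalities for
sticky spheres), whose global benchmark is the "combinatorial Kepler problem": the largest contact
number `C(n)` of a packing of `n` unit balls in `𝔼³`.

## Sources, as printed

* [Bezdek2011] K. Bezdek, *Contact numbers for congruent sphere packings in Euclidean 3-space*,
  Discrete Comput. Geom. 48 (2012) 298–309 = arXiv:1102.1198v2, §1 and Theorem 1.1 (read in the
  arXiv source `contact-numbers3.tex`, ll. 128–141): "If `𝒫` is a packing of `n` unit balls in
  `𝔼³`, then let `C(𝒫)` stand for the number of touching pairs in `𝒫` … Moreover, let `C(n)` be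
  the largest `C(𝒫)` for packings `𝒫` of `n` unit balls in `𝔼³`. … **Theorem 1.1.** (i)
  `C(n) < 6n − 0.695 n^{2/3}` for all `n ≥ 2`. (ii) Let `Λ` be any lattice of `𝔼³` with shortest
  non-zero lattice vector of length `2`. Then `C_Λ(n) < 6n − (3∛(18π)/π) n^{2/3} = 6n − 3.665… n^{2/3}`
  for all `n ≥ 2`. (iii) `6n − ∛486 n^{2/3} < C_fcc(n) ≤ C(n)` for all `n = k(2k²+1)/3` with
  `k ≥ 2`."  Proof of (iii) (ll. 339–352): the `n(k) = (2k³+k)/3` points of the face-centred cubic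
  lattice in a regular octahedron with `k` lattice points along each edge carry
  `C(𝒫_fcc(k)) = 4k³ − 6k² + 2k = 6 n(k) − 6k²` contacts.
* [BezdekReid2013] K. Bezdek, S. Reid, *Contact graphs of unit sphere packings revisited*,
  J. Geom. 104 (2013) 57–83 = arXiv:1210.5756v1 (source `Contact_Graphs_Revisited.tex`):
  "**Theorem 1.** (i) The number of touching pairs in an arbitrary packing of `n ≥ 2` unit balls in
  `𝔼³` is always less than `6n − 0.926 n^{2/3}`. (ii) The number of touching pairs in an arbitrary
  lattice packing of `n ≥ 2` unit balls in `𝔼³` is always less than `6n − (3∛(18π)/π) n^{2/3}`"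
  (ll. 55–62); "**Theorem 3.** The number of touching pairs (resp., triplets) in an arbitrary
  packing of spherical caps of angular radius `π/6` on `𝕊²` is at most `25` (resp., `11`)"
  (ll. 86–88; Problem 2 asks for `24` (resp., `10`)); and Theorem 2 (i): the number of touching
  triplets (resp., quadruples) in a packing of `n` unit balls is at most `25n/3` (resp., `11n/4`).
  Proof skeleton of Theorem 1 (i) (§2, ll. 105–262): with `r̂ = 1.58731` (`4/r̂ = 2.51998… < 2.52`,
  Hales's twelve-neighbour gap, *Dense Sphere Packings* Lemma 9.15) a twelve-kissed ball contributes
  no boundary to `U = ⋃ (c_i + r̂𝐁)`; `n vol(𝐁)/vol(U) < 0.7547` (the dodecahedral bound, DSP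
  Lemma 9.13); isoperimetry gives `svol(bd U) > 15.159805 n^{2/3}`; Molnár's cap-packing density
  `0.89332` gives `svol(bd U) < (24.53902/3)(n − m − k) + 24.53902 k` (`m` balls of degree `12`,
  `k` of degree `≤ 9`); hence `1.85335 n^{2/3} − 3k < n − m − k` and
  `C(n) ≤ ½(12n − (n−m−k) − 3k) < 6n − 0.926675 n^{2/3}`.
* [BezdekKhan2018] K. Bezdek, M. A. Khan, *Contact numbers for sphere packings*, Bolyai Soc. Math.
  Stud. 27 (2018) 25–47 = arXiv:1601.00145v2, Table 1 ("trivially known exact values for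
  `n = 2, 3, 4, 5`": `1, 3, 6, 9`; largest known `12, 15, 18, 21, 25, 29, 33, 36, …, 60` for
  `n = 6, …, 19`) and the Proposition of §"Empirical approaches" (`c(n,3) = 3n − 6` for `4 ≤ n ≤ 9`
  CONDITIONAL on the completeness of the Arkus–Manoharan–Brenner enumeration).  Exact `C(n)` is
  open in print for every `n ≥ 7`; `C(6) = 12` is the tree theorem `ArkusHoy_sixSpheres_holds`.

## Contents (namespace `Literature.Geometry.DiscreteGeometry`)

* `BezdekReid2013_contactNumber_lt` — NAMED FACT, Theorem 1 (i) of [BezdekReid2013] for labelled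
  packings (`x : Fin n → ℝ³` injective with `IsUnitBallPacking (range x)`; `C(𝒫) = contactNumber x`).
* `Bezdek2012_contactNumber_lt_of` — Theorem 1.1 (i) of [Bezdek2011] (`0.695`), PROVED from the
  named fact (it is weaker); `contactNumber_lt_six_mul_of` (`C(𝒫) < 6n`).
* `BezdekReid2013_capContacts` — NAMED FACT, Theorem 3 of [BezdekReid2013] in the equivalent
  "kissing shell" form: a finite set `S` on the sphere `‖x‖ = 2` with pairwise distances `≥ 2`
  (= centres of non-overlapping unit balls touching the unit ball at the origin = a packing of
  caps of angular radius `π/6`, two caps touching iff the centres are at distance `2`) has at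
  most `25` touching pairs and at most `11` touching triplets, counted below as ORDERED tuples
  (`≤ 50` ordered pairs, `≤ 66` ordered triples).  This is the per-ball LOCAL inequality behind
  Theorem 2 (i).
* Theorem 1.1 (iii) of [Bezdek2011], the lower-bound octahedra, PROVED for the instance `k = 4`
  (`n = 44`): `fccOctahedron44` is a unit-ball packing inside the fcc lattice `D₃` with exactly
  `168 = 6·44 − 6·4²` contacts and `6·44 − ∛486 · 44^{2/3} < 168`
  (`bezdek2012_fcc_lower_bound_k4`).  The instances `k = 2, 3` (`n = 6, 19`; `12`, `60` contacts)
  are the tree's `octahedralSix` (`contactNumber_six`) and `fccNucleus 6`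
  (`fccNucleus_packing_contacts`, `StickySphereClustersNarrow.lean`); the printed inequality for
  them is `bezdek2012_fcc_lower_bound_k2/k3` below (pure arithmetic).
  -- TODO(general form): (iii) for every `k ≥ 2` (closed-form lattice-point and contact counts of
  the octahedral fcc piece, `n(k) = (2k³+k)/3`, `C = 4k³ − 6k² + 2k`).

NOT vendored (deliberately, to keep the fact debt at two): Theorem 1.1 (ii) / Theorem 1 (ii)
(lattice packings, constant `3∛(18π)/π`), Theorem 2 (triplet/quadruple counts `25n/3`, `11n/4`),
Harborth's planar formula `⌊3n − √(12n − 3)⌋`.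
-/

noncomputable section

open Finset

namespace Literature.Geometry.DiscreteGeometry

open Literature.Barriers.AtomisticToContinuum
  (contactNumber intContactNumber intConfig contactNumber_scaled isUnitBallPacking_scaled)

/-- Euclidean `3`-space. -/
local notation "E3" => EuclideanSpace ℝ (Fin 3)

/-! ### The global upper bound -/

/-- **Bezdek–Reid 2013, Theorem 1 (i)** (improving Bezdek 2012, Theorem 1.1 (i), `0.695`): "The
number of touching pairs in an arbitrary packing of `n ≥ 2` unit balls in `𝔼³` is always less
than `6n − 0.926 n^{2/3}`."  Here a packing of `n` unit balls is a labelled configuration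
`x : Fin n → ℝ³` of `n` distinct centres pairwise at distance `≥ 2` (`IsUnitBallPacking`), and its
number of touching pairs is `contactNumber x`.  Proof in print: dodecahedral Voronoi bound
`0.7547` and twelve-neighbour gap `2.52` (Hales), isoperimetric inequality, Molnár's cap-packing
density `0.89332`, kissing number `12` — not formalised here.
[cite: BezdekReid2013, Theorem 1 (i)] -/
def BezdekReid2013_contactNumber_lt : Prop :=
  ∀ (n : ℕ) (x : Fin n → E3), 2 ≤ n → Function.Injective x →
    IsUnitBallPacking (Set.range x) →
      (contactNumber x : ℝ) < 6 * n - 0.926 * (n : ℝ) ^ ((2 : ℝ) / 3)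

/-- **Bezdek 2012, Theorem 1.1 (i)**: "`C(n) < 6n − 0.695 n^{2/3}` for all `n ≥ 2`" — for every
packing of `n ≥ 2` unit balls, from the sharper Bezdek–Reid constant `0.926`.
[cite: Bezdek2011, Theorem 1.1 (i)] -/
theorem Bezdek2012_contactNumber_lt_of (h : BezdekReid2013_contactNumber_lt)
    (n : ℕ) (x : Fin n → E3) (hn : 2 ≤ n) (hx : Function.Injective x)
    (hP : IsUnitBallPacking (Set.range x)) :
    (contactNumber x : ℝ) < 6 * n - 0.695 * (n : ℝ) ^ ((2 : ℝ) / 3) := by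
  have h1 := h n x hn hx hP
  have h2 : (0 : ℝ) ≤ (n : ℝ) ^ ((2 : ℝ) / 3) := Real.rpow_nonneg (Nat.cast_nonneg n) _
  nlinarith

/-- In particular the average degree of the contact graph is `< 12`: `C(𝒫) < 6n`.
[cite: BezdekReid2013, Theorem 1 (i)] -/
theorem contactNumber_lt_six_mul_of (h : BezdekReid2013_contactNumber_lt)
    (n : ℕ) (x : Fin n → E3) (hn : 2 ≤ n) (hx : Function.Injective x)
    (hP : IsUnitBallPacking (Set.range x)) :
    (contactNumber x : ℝ) < 6 * n := by
  have h1 := h n x hn hx hP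
  have h2 : (0 : ℝ) ≤ (n : ℝ) ^ ((2 : ℝ) / 3) := Real.rpow_nonneg (Nat.cast_nonneg n) _
  nlinarith

/-! ### The local bound on the kissing sphere (spherical caps of angular radius `π/6`) -/

/-- **Bezdek–Reid 2013, Theorem 3**: "The number of touching pairs (resp., triplets) in an arbitrary
packing of spherical caps of angular radius `π/6` on `𝕊²` is at most `25` (resp., `11`)."
Rendered on the sphere of radius `2` (the centres `S` of unit balls touching the unit ball at the
origin): caps of angular radius `π/6` about the directions of `S` are non-overlapping iff the
points of `S` are pairwise at distance `≥ 2`, and two caps touch iff the two centres are at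
distance exactly `2`; touching pairs/triplets are counted as ORDERED pairs/triples of `S`, hence
the bounds `2 · 25 = 50` and `3! · 11 = 66`.  (The cuboctahedron and the twisted cuboctahedron
have `24` touching pairs; Problem 2 of the paper asks whether `24` resp. `10` is the truth.)
Elementary but computational proof (§§5–6 of the paper), a theorem in print — not formalised
here. [cite: BezdekReid2013, Theorem 3] -/
def BezdekReid2013_capContacts : Prop :=
  ∀ S : Finset E3, (∀ x ∈ S, ‖x‖ = 2) → (∀ x ∈ S, ∀ y ∈ S, x ≠ y → 2 ≤ dist x y) →
    ((S ×ˢ S).filter (fun p => dist p.1 p.2 = 2)).card ≤ 50 ∧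
    ((S ×ˢ S ×ˢ S).filter
        (fun p => dist p.1 p.2.1 = 2 ∧ dist p.1 p.2.2 = 2 ∧ dist p.2.1 p.2.2 = 2)).card ≤ 66

/-! ### Bezdek's lower-bound octahedra (Theorem 1.1 (iii)): the instance `k = 4`, `n = 44` -/

/-- Integer model (fcc lattice `D₃ = {v ∈ ℤ³ : v₀ + v₁ + v₂ even}`, contact at squared distance
`2`) of Bezdek's octahedral fcc piece `𝒫_fcc(4)`: the `44 = 4·(2·4²+1)/3` lattice points `v` with
`|v₀ − 1| + |v₁| + |v₂| ∈ {1, 3}` — a regular octahedron of edge `3√2` (lattice units) centred at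
`(1,0,0)` with `4` lattice points along each edge. [cite: Bezdek2011, Theorem 1.1 (iii) and §2.3] -/
def fccOctahedron44Int : Fin 44 → Fin 3 → ℤ :=
  ![![-2, 0, 0], ![-1, -1, 0], ![-1, 0, -1], ![-1, 0, 1], ![-1, 1, 0], ![0, -2, 0],
    ![0, -1, -1], ![0, -1, 1], ![0, 0, -2], ![0, 0, 0], ![0, 0, 2], ![0, 1, -1], ![0, 1, 1],
    ![0, 2, 0], ![1, -3, 0], ![1, -2, -1], ![1, -2, 1], ![1, -1, -2], ![1, -1, 0], ![1, -1, 2],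
    ![1, 0, -3], ![1, 0, -1], ![1, 0, 1], ![1, 0, 3], ![1, 1, -2], ![1, 1, 0], ![1, 1, 2],
    ![1, 2, -1], ![1, 2, 1], ![1, 3, 0], ![2, -2, 0], ![2, -1, -1], ![2, -1, 1], ![2, 0, -2],
    ![2, 0, 0], ![2, 0, 2], ![2, 1, -1], ![2, 1, 1], ![2, 2, 0], ![3, -1, 0], ![3, 0, -1],
    ![3, 0, 1], ![3, 1, 0], ![4, 0, 0]]

/-- **Bezdek's octahedron `𝒫_fcc(4)`** as a configuration of `44` centres of unit balls (contact
distance `2`: the integer model scaled by `2/√2 = √2`). [cite: Bezdek2011, Theorem 1.1 (iii)] -/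
def fccOctahedron44 : Fin 44 → E3 :=
  intConfig fccOctahedron44Int (2 / Real.sqrt (2 : ℕ))

/-- All `44` points lie in the fcc lattice `D₃` (even coordinate sum): "with their centers lying on
a face-centered cubic lattice". [cite: Bezdek2011, Theorem 1.1 (iii)] -/
theorem fccOctahedron44Int_even :
    ∀ i : Fin 44, 2 ∣ (fccOctahedron44Int i 0 + fccOctahedron44Int i 1 + fccOctahedron44Int i 2) := by
  decide

/-- The `44` points are the lattice points of `D₃` on the two octahedral shells
`|v₀ − 1| + |v₁| + |v₂| ∈ {1, 3}` (membership as printed: "`k` lattice points along each of its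
edges", here `k = 4`). [cite: Bezdek2011, Theorem 1.1 (iii) and §2.3] -/
theorem fccOctahedron44Int_shell : ∀ i : Fin 44,
    |fccOctahedron44Int i 0 - 1| + |fccOctahedron44Int i 1| + |fccOctahedron44Int i 2| = 1 ∨
    |fccOctahedron44Int i 0 - 1| + |fccOctahedron44Int i 1| + |fccOctahedron44Int i 2| = 3 := by
  decide

/-- Distinct points are at squared distance `≥ 2` (so the scaled configuration is a packing and
the labelling is injective). [folklore] -/
private theorem sep_fccOctahedron44 : ∀ i j : Fin 44, i ≠ j →
    (2 : ℤ) ≤ sqNormInt (fccOctahedron44Int i - fccOctahedron44Int j) := by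
  decide +kernel

/-- Exactly `168 = 4·4³ − 6·4² + 2·4 = 6·44 − 6·4²` touching pairs ("`C(𝒫_fcc(k)) = 6n(k) − 6k²`").
[cite: Bezdek2011, §2.3 (proof of Theorem 1.1 (iii))] -/
theorem intContactNumber_fccOctahedron44 : intContactNumber fccOctahedron44Int 2 = 168 := by
  decide +kernel

/-- The labelling of `fccOctahedron44` is injective (`44` distinct balls).
[cite: Bezdek2011, Theorem 1.1 (iii)] -/
theorem fccOctahedron44_injective : Function.Injective fccOctahedron44 := by
  intro i j hij
  by_contra hne
  have hP := isUnitBallPacking_scaled fccOctahedron44Int (by norm_num : 0 < 2) sep_fccOctahedron44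
  have h2 := sep_fccOctahedron44 i j hne
  have hd : dist (fccOctahedron44 i) (fccOctahedron44 j) = 0 := by rw [hij, dist_self]
  have := Literature.Barriers.AtomisticToContinuum.dist_intConfig_sqrt fccOctahedron44Int
    (by norm_num : 0 < 2) i j
  rw [fccOctahedron44] at hd
  rw [hd] at this
  have hpos : (0 : ℝ) < 2 * Real.sqrt ((sqNormInt (fccOctahedron44Int i - fccOctahedron44Int j) : ℝ) / (2 : ℕ)) := by
    have : (0 : ℝ) < (sqNormInt (fccOctahedron44Int i - fccOctahedron44Int j) : ℝ) / (2 : ℕ) := by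
      apply div_pos
      · exact_mod_cast lt_of_lt_of_le (by norm_num : (0 : ℤ) < 2) h2
      · norm_num
    positivity
  linarith

/-- **`𝒫_fcc(4)` is a packing of `44` unit balls with `168` contacts.**
[cite: Bezdek2011, Theorem 1.1 (iii)] -/
theorem fccOctahedron44_packing_contacts :
    IsUnitBallPacking (Set.range fccOctahedron44) ∧ contactNumber fccOctahedron44 = 168 := by
  refine ⟨isUnitBallPacking_scaled _ (by norm_num) sep_fccOctahedron44, ?_⟩
  rw [fccOctahedron44, contactNumber_scaled _ (by norm_num : 0 < 2)]
  exact_mod_cast intContactNumber_fccOctahedron44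

/-- Cube of `a^{1/3} b^{2/3}`. [folklore] -/
private theorem rpow_third_mul_rpow_two_thirds_pow_three {a b : ℝ} (ha : 0 ≤ a) (hb : 0 ≤ b) :
    (a ^ ((1 : ℝ) / 3) * b ^ ((2 : ℝ) / 3)) ^ 3 = a * b ^ 2 := by
  rw [mul_pow, ← Real.rpow_natCast (a ^ ((1 : ℝ) / 3)), ← Real.rpow_natCast (b ^ ((2 : ℝ) / 3)),
    ← Real.rpow_mul ha, ← Real.rpow_mul hb]
  norm_num

/-- `6n − ∛486 · n^{2/3} < C` from the integer certificate `(6n − C)³ < 486 n²` (`C ≤ 6n`).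
[folklore] -/
private theorem bezdek_lower_of_cube {n C : ℕ} (hC : C ≤ 6 * n) (h : (6 * n - C) ^ 3 < 486 * n ^ 2) :
    (6 * n : ℝ) - (486 : ℝ) ^ ((1 : ℝ) / 3) * (n : ℝ) ^ ((2 : ℝ) / 3) < C := by
  have hX : (0 : ℝ) ≤ (486 : ℝ) ^ ((1 : ℝ) / 3) * (n : ℝ) ^ ((2 : ℝ) / 3) := by positivity
  have hcube := rpow_third_mul_rpow_two_thirds_pow_three (show (0:ℝ) ≤ 486 by norm_num)
    (Nat.cast_nonneg n)
  have hlt : ((6 * n - C : ℕ) : ℝ) ^ 3 < ((486 : ℝ) ^ ((1 : ℝ) / 3) * (n : ℝ) ^ ((2 : ℝ) / 3)) ^ 3 := by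
    rw [hcube]; exact_mod_cast h
  have := lt_of_pow_lt_pow_left₀ 3 hX hlt
  push_cast [Nat.cast_sub hC] at this
  linarith

/-- **Bezdek 2012, Theorem 1.1 (iii) at `k = 4`** (`n = 44 = 4(2·4²+1)/3`):
`6·44 − ∛486 · 44^{2/3} < C(𝒫_fcc(4)) = 168` (numerically `166.0… < 168`).
[cite: Bezdek2011, Theorem 1.1 (iii)] -/
theorem bezdek2012_fcc_lower_bound_k4 :
    (6 * 44 : ℝ) - (486 : ℝ) ^ ((1 : ℝ) / 3) * (44 : ℝ) ^ ((2 : ℝ) / 3) <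
      contactNumber fccOctahedron44 := by
  rw [fccOctahedron44_packing_contacts.2]
  exact_mod_cast bezdek_lower_of_cube (n := 44) (C := 168) (by norm_num) (by norm_num)

/-- **Theorem 1.1 (iii) at `k = 2`** (`n = 6`, the regular octahedron, `12` contacts; tree:
`octahedralSix`, `contactNumber_six`): `6·6 − ∛486 · 6^{2/3} < 12`. [cite: Bezdek2011, Theorem 1.1 (iii)] -/
theorem bezdek2012_fcc_lower_bound_k2 :
    (6 * 6 : ℝ) - (486 : ℝ) ^ ((1 : ℝ) / 3) * (6 : ℝ) ^ ((2 : ℝ) / 3) < 12 := by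
  exact_mod_cast bezdek_lower_of_cube (n := 6) (C := 12) (by norm_num) (by norm_num)

/-- **Theorem 1.1 (iii) at `k = 3`** (`n = 19`, the `19`-ball octahedron = centred cuboctahedron with
its six square faces capped, `60` contacts; tree: `fccNucleus 6`, `fccNucleus_packing_contacts`):
`6·19 − ∛486 · 19^{2/3} < 60`. [cite: Bezdek2011, Theorem 1.1 (iii)] -/
theorem bezdek2012_fcc_lower_bound_k3 :
    (6 * 19 : ℝ) - (486 : ℝ) ^ ((1 : ℝ) / 3) * (19 : ℝ) ^ ((2 : ℝ) / 3) < 60 := by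
  exact_mod_cast bezdek_lower_of_cube (n := 19) (C := 60) (by norm_num) (by norm_num)

end Literature.Geometry.DiscreteGeometry

end
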